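import Literature.NumberTheory.EllipticCurves.PAdicOneVariableTraceCriterion
import Literature.NumberTheory.EllipticCurves.PAdicOneVariableUnitsMoments
import Mathlib.NumberTheory.Padics.Complex
import Mathlib.RingTheory.RootsOfUnity.AlgebraicallyClosed
import HarnessLib

/-!
# The support criterion (de Shalit 1987, I.3.3 (7) ⟺ (7′)) over `ℂ_p`: the roots of unity supplied

`PAdicOneVariableTraceCriterion.lean` and `PAdicOneVariableUnitsMoments.lean` state the support
criterion and the socket identity `∫ x^{k+1} d(restrictUnits (x⁻¹ · D_H)) = [S^0] D^k H` for a general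
complete non-archimedean field `𝕜` over `ℚ_p`, with the primitive `p^{n+1}`-th roots of unity as
hypotheses. Over `𝕜 = ℂ_p` (Mathlib `PadicComplex`, algebraically closed of characteristic `0`, the
coefficient field of the tree's `GroupDistribution … ℂ_[p]` of de Shalit II.4.12) those roots exist
(`HasEnoughRootsOfUnity`), so the hypotheses disappear:

* `PadicComplex.exists_isPrimitiveRoot_pow`: `∃ ζ : ℂ_p`, `IsPrimitiveRoot ζ (p^(n+1))`;
* **`PadicComplex.forall_invAmice₁_μ_eq_zero_of_nthRoots`**: if `Σ_{w^p=1} Σ_m [S^m]H (εw − 1)^m = 0`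
  for every `p`-power root of unity `ε ∈ ℂ_p`, then `D_H` vanishes on every non-unit class;
* **`PadicComplex.integral_restrictUnits_invAmice₁_eq_of_nthRoots`** and
  **`PadicComplex.integral_restrictUnits_density_unitInv_pow_succ_eq_constantCoeff`** (the socket) under
  that single hypothesis.

Everything is a theorem; no named facts, no definitions, no instances, no `sorry`.

## References

* [deShalit1987] E. de Shalit, *Iwasawa theory of elliptic curves with complex multiplication* (1987),
  I.3.3 (7)–(8) (p. 17–18), I.3.5 (11) (p. 18), II.4.7 (p. 60: "`μ_β⁰` … `ℂ_p`-valued characters").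
-/

noncomputable section

open Filter Topology Finset
open scoped fwdDiff Classical

namespace Literature.NumberTheory.EllipticCurves

namespace PadicComplex

variable {p : ℕ} [Fact p.Prime]

/-- `ℂ_p` has primitive `p^{n+1}`-th roots of unity (algebraically closed, characteristic `0`).
[cite: deShalit1987, II.4.7 (p. 60)] -/
theorem exists_isPrimitiveRoot_pow (n : ℕ) : ∃ ζ : ℂ_[p], IsPrimitiveRoot ζ (p ^ (n + 1)) := by
  haveI : NeZero ((p : ℕ) : ℂ_[p]) := ⟨Nat.cast_ne_zero.mpr (Fact.out : p.Prime).ne_zero⟩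
  exact HasEnoughRootsOfUnity.exists_primitiveRoot ℂ_[p] (p ^ (n + 1))

variable {H : PowerSeries ℂ_[p]} {C : ℝ}

/-- **The support criterion over `ℂ_p`**: if the `Ĝ_m`-trace of `H` vanishes at every `p`-power root of
unity `ε ∈ ℂ_p` (`Σ_{w^p = 1} Σ_m [S^m]H (εw − 1)^m = 0`), then `D_H` vanishes on every non-unit class.
[cite: deShalit1987, I.3.3 (7)–(7′) (p. 17)] -/
theorem forall_invAmice₁_μ_eq_zero_of_nthRoots (hC : ∀ m, ‖PowerSeries.coeff m H‖ ≤ C)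
    (htrace : ∀ ε : ℂ_[p], (∃ n : ℕ, ε ^ p ^ n = 1) →
      ∑ w ∈ Polynomial.nthRootsFinset p (1 : ℂ_[p]),
        ∑' m : ℕ, PowerSeries.coeff m H * (ε * w - 1) ^ m = 0)
    (n : ℕ) (b : ZMod (p ^ (n + 1))) (hb : ¬ IsUnit b) : (invAmice₁ p H hC).μ (n + 1) b = 0 := by
  obtain ⟨ζ, hζ⟩ := exists_isPrimitiveRoot_pow (p := p) n
  exact (forall_invAmice₁_μ_eq_zero_iff_nthRoots hC n hζ).mpr (fun ε hε ↦ htrace ε ⟨n + 1, hε⟩) b hb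

/-- **`∫ f d(D_H|_{ℤ_p^×}) = ∫ f dD_H` over `ℂ_p`** under the trace hypothesis, for every uniformly continuous
`f`. [cite: deShalit1987, I.3.3 (7)–(8) (p. 17–18)] -/
theorem integral_restrictUnits_invAmice₁_eq_of_nthRoots (hC : ∀ m, ‖PowerSeries.coeff m H‖ ≤ C)
    (htrace : ∀ ε : ℂ_[p], (∃ n : ℕ, ε ^ p ^ n = 1) →
      ∑ w ∈ Polynomial.nthRootsFinset p (1 : ℂ_[p]),
        ∑' m : ℕ, PowerSeries.coeff m H * (ε * w - 1) ^ m = 0)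
    {f : ℤ_[p] → ℂ_[p]} (hf : UniformContinuous f) :
    (restrictUnits (invAmice₁ p H hC)).integral f = (invAmice₁ p H hC).integral f :=
  Literature.NumberTheory.EllipticCurves.integral_restrictUnits_invAmice₁_eq_of_nthRoots hC
    (exists_isPrimitiveRoot_pow (p := p)) htrace hf

/-- **THE SOCKET OVER `ℂ_p`**: under the trace hypothesis,
`∫ x^{k+1} d(restrictUnits (x⁻¹ · D_H)) = [S^0] D^k H` for every `k` (de Shalit's (11) for
`μ_β♭ = (x⁻¹·D_{H_β})|_{ℤ_p^×}`, `H_β = D log̃ g_β ∘ θ`). [cite: deShalit1987, I.3.5 (11) (p. 18), I.3.3 (7)–(8) (p. 17)] -/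
theorem integral_restrictUnits_density_unitInv_pow_succ_eq_constantCoeff
    (hC : ∀ m, ‖PowerSeries.coeff m H‖ ≤ C)
    (htrace : ∀ ε : ℂ_[p], (∃ n : ℕ, ε ^ p ^ n = 1) →
      ∑ w ∈ Polynomial.nthRootsFinset p (1 : ℂ_[p]),
        ∑' m : ℕ, PowerSeries.coeff m H * (ε * w - 1) ^ m = 0) (k : ℕ) :
    (restrictUnits ((invAmice₁ p H hC).density (ProfiniteTower.padicInt_isUniform p) (unitInv ℂ_[p])
        uniformContinuous_unitInv norm_unitInv_le)).integral (fun x ↦ padicIntCast ℂ_[p] (x ^ (k + 1))) =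
      PowerSeries.constantCoeff (mahlerD^[k] H) :=
  Literature.NumberTheory.EllipticCurves.integral_restrictUnits_density_unitInv_pow_succ_eq_constantCoeff hC
    (forall_invAmice₁_μ_eq_zero_of_nthRoots hC htrace) k

end PadicComplex

end Literature.NumberTheory.EllipticCurves

end
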